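import Summits.BirchSwinnertonDyer.BirchSwinnertonDyer.Theorems.GenusKolyvaginAtTwoPowDvdShaCardAtTwoRTBottomRungTransverseSocket
import HarnessLib

/-!
# Route `CMKolyvaginAtInertTwo`, crux `CMKolyvaginExactAtInertTwo` (stmt-BirchSwinnertonDyer-24277), `stub_lower` — W-UP on H₂,
# FILE W4a: THE TRANSVERSE SOCKET AT LEVEL `2` — the descended Kolyvagin class `desc c₁(n′)` is TRANSVERSE at every own prime of
# index `≥ 2` (Howard's Lemma 2.7.3 at `2`, margin one, read at `F²`; gk2-p5 g31's `hTr_of_three_le` with the doubling removed)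

Seat `bsd-line-cmk2-p1` g19 (cell `bsd-print-cf2`), `--supports stmt-BirchSwinnertonDyer-24277` (helper; closes nothing).
THEOREMS ONLY (no definition, no named fact, no `sorry`).  BSD is NOT proved by any of this; the crux is not closed here.

WHY.  The level-`2` engine (files W3a/W3b) needs, at the DEEP own primes `t` of the `k`-minimal product, the transversality of the
descended classes `b = desc c₁(n)` and `Z = desc c₁(nℓ′)` in gk2-p3's `∀ 𝔓 ∀ F ∀ c₀` form: `[Z, F] ∈ (F − 1)E[2]`.  gk2-p5 g31 proved the
level-`4` socket `[2•Z, F] ∈ (F − 1)E[4]` for own primes of index `≥ 3` (`TransverseValue.hTr_of_three_le`) from the K-side value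
`[c_k(n′), τ_{F²}]_K = 0` (`h1Eval_kolyvaginClass_eq_zero_of_absGaloisRestrict_eq_sq`, ANY level `2^k`, own prime of index `≥ k + 1`)
and LEAD g18's reduction.  THIS FILE is the same at level `2` WITHOUT doubling: on `E[2]` with its regular frame `P₀, c₀P₀`,
`ker(1 + c₀) = im(c₀ − 1)`; `[Z, F·F] = (1 + F)[Z, F]`, so `[Z, F·F] = 0 ⟹ [Z, F] ∈ (F − 1)E[2]`; and `[Z, F·F] = 0 ⟸ [res_K Z, τ] = 0`.
* §1 `exists_eq_conj_smul_sub_of_add_conj_smul_eq_zero_two`, `exists_h1Eval_eq_smul_sub_of_sq_two`, `h1Eval_sq_eq_zero_of_resTorsion_two`;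
* §2 **`hTr_two`** — the socket: for `Z` descending `c₁(n′)` (`n′` square-free of Zhang–Kolyvagin primes), an own prime `ℓ ∣ n′` of index
  `≥ 2`, every `𝔓 ∣ ℓ`, `F` Frobenius at `𝔓`, `c₀` complex conjugation with `F = c₀` on `E[2]`: `∃ P₁, [Z, F] = F•P₁ − P₁`.

References: [McCallumLMS1991] §4 Prop. 4.4 (1), §5 Lemma 5.3; [Howard2004HeegnerKolyvagin] Lemma 2.7.3; [GrossLMS1991] §3 (3.3), §9.
-/

set_option autoImplicit false
-- the Theorems namespace of this sub repeats the summit name by design (D-0017 nested layout)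
set_option linter.dupNamespace false

noncomputable section

open scoped Classical Pointwise

open WeierstrassCurve NumberField IsDedekindDomain Field
open Literature.NumberTheory.EllipticCurves Literature.NumberTheory.GaloisRepresentations
open Literature.NumberTheory.GaloisCohomology
open Literature.NumberTheory.EllipticCurves.ModularForms
open Summit.BirchSwinnertonDyer.Rank1Residual

namespace Summit.BirchSwinnertonDyer.BirchSwinnertonDyer.Theorems.KolyvaginLowerTwo

open Summit.BirchSwinnertonDyer.BirchSwinnertonDyer.Theorems.GenusExact

/-! ## §1 The reduction at level `2` (no doubling) -/

section Reduction

/-- **On the regular `ℤ/2[c₀]`-module `E[2]` the kernel of `1 + c₀` is the image of `c₀ − 1`** (displayed frame `P₀, c₀P₀`, free over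
`ℤ/2`): `x + c₀•x = 0 ⟹ x = c₀•P₁ − P₁`. [cite: McCallumLMS1991, §5 Lemma 5.3] [cite: GrossLMS1991, §3 (3.3)] -/
theorem exists_eq_conj_smul_sub_of_add_conj_smul_eq_zero_two {W : WeierstrassCurve ℚ} {c₀ : absoluteGaloisGroup ℚ}
    (hc₀ : ∀ P : geomTorsion W ((2 ^ 1 : ℕ) : ℤ), c₀ • c₀ • P = P) {P₀ : geomTorsion W ((2 ^ 1 : ℕ) : ℤ)}
    (hgen : ∀ Q : geomTorsion W ((2 ^ 1 : ℕ) : ℤ), ∃ a b : ℤ, Q = a • P₀ + b • c₀ • P₀)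
    (hfree : ∀ a b : ℤ, a • P₀ + b • c₀ • P₀ = 0 → (2 : ℤ) ∣ a ∧ (2 : ℤ) ∣ b)
    {x : geomTorsion W ((2 ^ 1 : ℕ) : ℤ)} (hx : x + c₀ • x = 0) :
    ∃ P₁ : geomTorsion W ((2 ^ 1 : ℕ) : ℤ), x = c₀ • P₁ - P₁ := by
  obtain ⟨a, b, hab⟩ := hgen x
  have h2 : ∀ Q : geomTorsion W ((2 ^ 1 : ℕ) : ℤ), (2 : ℤ) • Q = 0 := fun Q ↦ by
    have h := AddSubgroup.torsionBy.nsmul Q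
    rw [← natCast_zsmul] at h
    exact_mod_cast h
  have hsum : (a + b) • P₀ + (a + b) • c₀ • P₀ = 0 := by
    have h := hx
    rw [hab, smul_add, smul_comm c₀ a P₀, smul_comm c₀ b (c₀ • P₀), hc₀] at h
    rw [← h, add_smul, add_smul]
    abel
  obtain ⟨⟨k, hk⟩, -⟩ := hfree (a + b) (a + b) hsum
  refine ⟨-(a • P₀), ?_⟩
  have hb : b = 2 * k - a := by linarith
  rw [hab, hb, sub_smul, mul_smul, h2, zero_sub, smul_neg, smul_comm c₀ a P₀]
  abel

/-- **Transversality at `F` from the vanishing of `[Z, F·F]` (level `2`).**  For `Z ∈ H¹(ℚ, E[2])`, `F ∈ Γ_ℚ` acting on `E[2]` as the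
involution `c₀` of a regular frame: `[Z, F·F] = [Z, F] + F·[Z, F] = (1 + c₀)[Z, F]` (`h1Eval_mul_smul`), so `[Z, F·F] = 0` gives
`[Z, F] ∈ ker(1 + c₀) = im(c₀ − 1)`, i.e. `[Z, F] = F•P₁ − P₁`. [cite: McCallumLMS1991, §4 Prop. 4.4 (1)] [cite: GrossLMS1991, §9] -/
theorem exists_h1Eval_eq_smul_sub_of_sq_two {W : WeierstrassCurve ℚ} {F c₀ : absoluteGaloisGroup ℚ}
    (hF : ∀ P : geomTorsion W ((2 ^ 1 : ℕ) : ℤ), F • P = c₀ • P)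
    (hc₀ : ∀ P : geomTorsion W ((2 ^ 1 : ℕ) : ℤ), c₀ • c₀ • P = P) {P₀ : geomTorsion W ((2 ^ 1 : ℕ) : ℤ)}
    (hgen : ∀ Q : geomTorsion W ((2 ^ 1 : ℕ) : ℤ), ∃ a b : ℤ, Q = a • P₀ + b • c₀ • P₀)
    (hfree : ∀ a b : ℤ, a • P₀ + b • c₀ • P₀ = 0 → (2 : ℤ) ∣ a ∧ (2 : ℤ) ∣ b)
    (Z : galH1Torsion W ((2 ^ 1 : ℕ) : ℤ)) (h0 : h1Eval W ((2 ^ 1 : ℕ) : ℤ) Z (F * F) = 0) :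
    ∃ P₁ : geomTorsion W ((2 ^ 1 : ℕ) : ℤ), h1Eval W _ Z F = F • P₁ - P₁ := by
  set x := h1Eval W ((2 ^ 1 : ℕ) : ℤ) Z F with hx_def
  have hsq : h1Eval W ((2 ^ 1 : ℕ) : ℤ) Z (F * F) = x + c₀ • x := by
    rw [GenusExact.FrobeniusCriterion.h1Eval_mul_smul, ← hx_def, hF]
  have hker : x + c₀ • x = 0 := by rw [← hsq, h0]
  obtain ⟨P₁, hP₁⟩ := exists_eq_conj_smul_sub_of_add_conj_smul_eq_zero_two hc₀ hgen hfree hker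
  refine ⟨P₁, ?_⟩
  rw [hP₁, hF]

/-- **Transfer to the K-side (level `2`).**  If `τ ∈ Γ_K` restricts to `F·F` and fixes `E_K[2]`, then `[res_K Z, τ] = 0` implies
`[Z, F·F] = 0` (`h1Eval_resTorsion_eq`, injectivity of the coefficient map). [cite: SerreGaloisCohomology1997, I §2.4]
[cite: Howard2004HeegnerKolyvagin, Lemma 2.7.3] -/
theorem h1Eval_sq_eq_zero_of_resTorsion_two {K : Type} [Field K] [NumberField K] {W : WeierstrassCurve ℚ} [W.IsElliptic]
    {F : absoluteGaloisGroup ℚ} (Z : galH1Torsion W ((2 ^ 1 : ℕ) : ℤ)) {τ : absoluteGaloisGroup K}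
    (hτF : resGal (K := ℚ) K τ = F * F) (hτ : τ ∈ torsionFixing (W.baseChange K) ((2 ^ 1 : ℕ) : ℤ))
    (hK : h1Eval (W.baseChange K) ((2 ^ 1 : ℕ) : ℤ) (resTorsion W K ((2 ^ 1 : ℕ) : ℤ) Z) τ = 0) :
    h1Eval W ((2 ^ 1 : ℕ) : ℤ) Z (F * F) = 0 := by
  have h := SelmerDescent.h1Eval_resTorsion_eq W K ((2 ^ 1 : ℕ) : ℤ) Z hτ
  rw [hτF] at h
  rw [h] at hK
  exact (map_eq_zero_iff _ (torsionBaseChangeMap_injective W K _)).mp hK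

end Reduction

/-! ## §2 The socket at level `2` -/

section Socket

variable {K : Type} [Field K] [NumberField K] (W : WeierstrassCurve ℚ) [W.IsElliptic] [W.IsGloballyMinimal]
  [NeZero (W.conductorNorm ℤ)]

/-- **THE TRANSVERSE SOCKET AT LEVEL `2`, PROVED.**  On `Δ < 0`, `K` imaginary quadratic with `d_K` odd `≠ −3`: for a ℚ-class `Z` over
`E[2]` descending the level-`2` Kolyvagin class `c₁(n′)` of a square-free product `n′` of Zhang–Kolyvagin primes, an own prime `ℓ ∣ n′` of
index `≥ 2` (margin one), a place `v ∋ ℓ`, and an arithmetic Frobenius `F` above `ℓ` acting on `E[2]` as a complex conjugation `c₀`: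
`[Z, F] = F•P₁ − P₁` for some `P₁`.  (Howard's Lemma 2.7.3 at `2` read at `τ_{F²}`: gk2-p5's
`h1Eval_kolyvaginClass_eq_zero_of_absGaloisRestrict_eq_sq` at `k = 1`, then §1.)
[cite: McCallumLMS1991, §4 Prop. 4.4 (1), §5 proof of Prop. 5.2 (13)] [cite: Howard2004HeegnerKolyvagin, Lemma 2.7.3] [cite: GrossLMS1991, §9] -/
theorem hTr_two (hK : IsImaginaryQuadratic K) (hodd : Odd (NumberField.discr K)) (h3 : NumberField.discr K ≠ -3)
    (hΔ : W.Δ < 0) (Dt : ModularParametrizationData W (W.conductorNorm ℤ)) (β : ℤ) (ι : K →+* ℂ)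
    [∀ j : ℕ, NumberField (ringClassField K ι j)] :
    ∀ (n' : ℕ) (d' : KolyvaginHeegnerData Dt β ι n') (Z : galoisCohomology (W.torsionGaloisModule ((2 ^ 1 : ℕ) : ℤ)) 1),
      Squarefree n' →
      (∀ q ∈ n'.primeFactors, Zhang2014.IsKolyvaginPrime (W.conductorNorm ℤ) W K 2 q ∧ 1 ≤ Zhang2014.kolyvaginIndex W 2 q) →
      resTorsion W K ((2 ^ 1 : ℕ) : ℤ) Z = d'.kolyvaginClass Nat.prime_two 1 →
      ∀ (v : HeightOneSpectrum (𝓞 ℚ)) (ℓ : ℕ), ℓ ∈ n'.primeFactors → (ℓ : 𝓞 ℚ) ∈ v.asIdeal →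
        2 ≤ Zhang2014.kolyvaginIndex W 2 ℓ →
        ∀ 𝔓 ∈ v.primesAbove, ∀ F c₀ : absoluteGaloisGroup ℚ, IsArithFrobAt (𝓞 ℚ) F 𝔓 →
          IsComplexConjugation (Rat.castHom ℝ) c₀ → (∀ P : geomTorsion W ((2 ^ 1 : ℕ) : ℤ), F • P = c₀ • P) →
          ∃ P₁ : geomTorsion W ((2 ^ 1 : ℕ) : ℤ), h1Eval W _ Z F = F • P₁ - P₁ := by
  intro n' d' Z hn' hn'K hZ v ℓ hℓ hℓv h2ℓ 𝔓 h𝔓 F c₀ hF hc₀ hFc₀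
  have h2K : Module.finrank ℚ K = 2 := hK.1
  have hD : NumberField.discr K < -4 := IsImaginaryQuadratic.discr_lt_neg_four_of_odd hK hodd h3
  -- the regular frame of `c₀` on `E[2]` (`Δ < 0`)
  obtain ⟨P₀, -, hgen, hfree⟩ := FrobeniusCriterion.exists_regular_generator_of_Δ_neg W hΔ hc₀ (M := 1) le_rfl
  have hc₀c₀ : ∀ P : geomTorsion W ((2 ^ 1 : ℕ) : ℤ), c₀ • c₀ • P = P := fun P ↦ by
    rw [← mul_smul, ← pow_two, hc₀.sq_eq_one, one_smul]
  have hfree2 : ∀ a b : ℤ, a • P₀ + b • c₀ • P₀ = 0 → (2 : ℤ) ∣ a ∧ (2 : ℤ) ∣ b := fun a b h ↦ by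
    have h' := hfree a b h
    norm_num at h'
    exact h'
  have hFF : ∀ Q : geomTorsion W ((2 ^ 1 : ℕ) : ℤ), F • F • Q = Q := fun Q ↦ by rw [hFc₀, hFc₀, hc₀c₀]
  refine exists_h1Eval_eq_smul_sub_of_sq_two hFc₀ hc₀c₀ hgen hfree2 Z ?_
  -- `τ ∈ Γ_K` over `F·F`, fixing `E_K[2]`
  obtain ⟨θ, hθQ, hθ⟩ := exists_sq_eq_discr_not_mem_range K h2K
  have hθ' : θ ∉ (algebraMap ℚ K).range := fun h ↦ hθQ (RingHom.mem_range.mp h)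
  obtain ⟨τ, hτF⟩ := SelmerDescent.sq_mem_range_absGaloisRestrict_of_sq_eq h2K hθ' hθ F
  have hτF' : absGaloisRestrict ℚ K τ = F * F := hτF
  have hτF'' : resGal (K := ℚ) K τ = F * F := hτF
  have hτT : τ ∈ torsionFixing (W.baseChange K) ((2 ^ 1 : ℕ) : ℤ) := by
    rw [mem_torsionFixing_iff]
    intro Q
    obtain ⟨P, rfl⟩ := (torsionBaseChangeMap_bijective K W ((2 ^ 1 : ℕ) : ℤ)).2 Q
    rw [← torsionBaseChangeMap_smul, hτF'', mul_smul, hFF]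
  refine h1Eval_sq_eq_zero_of_resTorsion_two Z hτF'' hτT ?_
  rw [hZ]
  exact TransverseValue.h1Eval_kolyvaginClass_eq_zero_of_absGaloisRestrict_eq_sq W hK hD Dt β ι 1 hn' hn'K d' hℓ (by omega) hℓv h𝔓
    hF hτF' hτT

end Socket

end Summit.BirchSwinnertonDyer.BirchSwinnertonDyer.Theorems.KolyvaginLowerTwo

end
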